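import Summits.AnomalousDissipation.AnomalousDissipation.Theorems.SawtoothPulseCascadeK1LocalisedCascadeKHStablePulseResponse

/-!
# K2 lane (route-2 `SawtoothPulseCascade`, crux dir `K1LocalisedCascade`): response of the stable block to ONE PIECE of the single-mode forcing

Helper file of the K2 lane (ACL item stmt-AnomalousDissipation-19491; S2-cert forced part / P1″). By `…KHForcingClosedForm` the single-mode source is a sum of
three PIECES `e^{iφ₀s}·(c₁ J(μ₁ + i(ν₀+νs); y₁,y₂) + c₂ J(μ₂ + i(ν₀+νs); y₁,y₂))`, `J(λ; y₁,y₂) = (e^{λy₂} − e^{λy₁})/λ` (`μ₁ = 2πa = −μ₂`, `ν₀ = 2πξ`,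
`ν = ±2πa`, `φ₀ ∈ {πas-frequencies 0, ±πa}`). Expanding the two end points, a piece is FOUR Lorentzian terms
`± e^{i(φ₀ + νy_b)s} · (c_j e^{μ_j y_b} e^{iν₀y_b})/(μ_j + i(ν₀+νs))` (`pieceTerm_eq`), so the Duhamel integral of a piece against a propagator entry
`k(θ−s) ∈ {cos(ω(θ−s)), sin(ω(θ−s))/ω}` is bounded by the sum of the four per-term bounds of `…KHStablePulseResponse`:
* `norm_integral_kernel_piece_le`: GENERIC in the kernel `k` — from a per-term hypothesis
  `‖∫₀^θ k e^{iφs} C/(μ+i(ν₀+νs))‖ ≤ ‖C‖(2+π)/|μ|·(1/|φ−ω| + 1/|φ+ω|)·r` it derives the four-term bound for the piece;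
* `norm_integral_cos_piece_le`, `norm_integral_sin_piece_le`: the instances `r = 1/2` and `r = 1/(2|ω|)`.
No definitions; no statement about the crux. [folklore] [problem: turb]
-/

-- `Summit.<Summit>.<Problem>`: single-conjunct summit, the duplicate namespace segment is deliberate.
set_option linter.dupNamespace false

noncomputable section

namespace Summit.AnomalousDissipation.AnomalousDissipation.Theorems.SawtoothPulseCascade.K2PhaseBudget

open Set MeasureTheory intervalIntegral

/-! ## §1 One end-point term of a piece is a Lorentzian term -/

/-- `e^{iφ₀s} · c · e^{(μ + i(ν₀+νs))y}/(μ + i(ν₀+νs)) = e^{i(φ₀+νy)s} · (c e^{μy} e^{iν₀y})/(μ + i(ν₀+νs))`. [folklore] -/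
theorem pieceTerm_eq (c : ℂ) (μ ν₀ ν φ₀ y s : ℝ) :
    Complex.exp ((φ₀ * s : ℝ) * Complex.I) * (c * Complex.exp (((μ : ℂ) + ((ν₀ + ν * s : ℝ) : ℂ) * Complex.I) * y)) /
        ((μ : ℂ) + ((ν₀ + ν * s : ℝ) : ℂ) * Complex.I) =
      Complex.exp ((((φ₀ + ν * y) * s : ℝ)) * Complex.I) *
        ((c * Complex.exp ((μ * y : ℝ)) * Complex.exp ((ν₀ * y : ℝ) * Complex.I)) / ((μ : ℂ) + ((ν₀ + ν * s : ℝ) : ℂ) * Complex.I)) := by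
  have key : Complex.exp ((φ₀ * s : ℝ) * Complex.I) * Complex.exp (((μ : ℂ) + ((ν₀ + ν * s : ℝ) : ℂ) * Complex.I) * y) =
      Complex.exp ((((φ₀ + ν * y) * s : ℝ)) * Complex.I) * (Complex.exp ((μ * y : ℝ)) * Complex.exp ((ν₀ * y : ℝ) * Complex.I)) := by
    rw [← Complex.exp_add, ← Complex.exp_add, ← Complex.exp_add]; congr 1; push_cast; ring
  rw [← mul_div_assoc]
  congr 1
  linear_combination c * key

/-- The Lorentzian term with kernel: continuity of `s ↦ k(s) · e^{iφs} · C/(μ + i(ν₀+νs))` for continuous real `k`. [folklore] -/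
theorem continuous_kernel_mul_lorentz {k : ℝ → ℝ} (hk : Continuous k) (C : ℂ) {μ : ℝ} (hμ : μ ≠ 0) (φ ν₀ ν : ℝ) :
    Continuous fun s : ℝ => (k s : ℂ) * (Complex.exp ((φ * s : ℝ) * Complex.I) * (C / ((μ : ℂ) + ((ν₀ + ν * s : ℝ) : ℂ) * Complex.I))) :=
  (Complex.continuous_ofReal.comp hk).mul (continuous_exp_mul_lorentz C hμ φ ν₀ ν)

/-! ## §2 The four-term bound for one piece, generic in the propagator entry -/

/-- **Response to one piece, generic kernel.** Let `k` be a continuous real kernel obeying the per-term bound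
`‖∫₀^θ k(s) e^{iφs} C/(μ+i(ν₀+νs)) ds‖ ≤ ‖C‖(2+π)/|μ| · (1/|φ−ω| + 1/|φ+ω|) · r` for all `C`, `μ ≠ 0`, `φ` with `φ ∓ ω ≠ 0`. Then for the piece
`e^{iφ₀s}(c₁J(μ₁+i(ν₀+νs);y₁,y₂) + c₂J(μ₂+i(ν₀+νs);y₁,y₂))` with end-point phases `φ_b = φ₀ + νy_b` off resonance,
`‖∫₀^θ k · piece‖ ≤ Σ_{b=1,2} Σ_{j=1,2} ‖c_j‖e^{μ_jy_b}(2+π)/|μ_j| · (1/|φ_b−ω| + 1/|φ_b+ω|) · r`. [folklore] -/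
theorem norm_integral_kernel_piece_le {k : ℝ → ℝ} (hk : Continuous k) {ω r θ : ℝ}
    (hterm : ∀ (C : ℂ) (μ φ ν₀ ν : ℝ), μ ≠ 0 → φ - ω ≠ 0 → φ + ω ≠ 0 →
      ‖∫ s in (0 : ℝ)..θ, (k s : ℂ) * Complex.exp ((φ * s : ℝ) * Complex.I) * (C / ((μ : ℂ) + ((ν₀ + ν * s : ℝ) : ℂ) * Complex.I))‖ ≤
        ‖C‖ * (2 + Real.pi) / |μ| * (1 / |φ - ω| + 1 / |φ + ω|) * r)
    (c₁ c₂ : ℂ) {μ₁ μ₂ : ℝ} (hμ₁ : μ₁ ≠ 0) (hμ₂ : μ₂ ≠ 0) (ν₀ ν φ₀ y₁ y₂ : ℝ)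
    (h1m : φ₀ + ν * y₁ - ω ≠ 0) (h1p : φ₀ + ν * y₁ + ω ≠ 0) (h2m : φ₀ + ν * y₂ - ω ≠ 0) (h2p : φ₀ + ν * y₂ + ω ≠ 0) :
    ‖∫ s in (0 : ℝ)..θ, (k s : ℂ) * (Complex.exp ((φ₀ * s : ℝ) * Complex.I) *
        (c₁ * ((Complex.exp (((μ₁ : ℂ) + ((ν₀ + ν * s : ℝ) : ℂ) * Complex.I) * y₂) -
                Complex.exp (((μ₁ : ℂ) + ((ν₀ + ν * s : ℝ) : ℂ) * Complex.I) * y₁)) / ((μ₁ : ℂ) + ((ν₀ + ν * s : ℝ) : ℂ) * Complex.I)) +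
         c₂ * ((Complex.exp (((μ₂ : ℂ) + ((ν₀ + ν * s : ℝ) : ℂ) * Complex.I) * y₂) -
                Complex.exp (((μ₂ : ℂ) + ((ν₀ + ν * s : ℝ) : ℂ) * Complex.I) * y₁)) / ((μ₂ : ℂ) + ((ν₀ + ν * s : ℝ) : ℂ) * Complex.I))))‖ ≤
      (‖c₁‖ * Real.exp (μ₁ * y₂) * (2 + Real.pi) / |μ₁| * (1 / |φ₀ + ν * y₂ - ω| + 1 / |φ₀ + ν * y₂ + ω|) * r +
        ‖c₁‖ * Real.exp (μ₁ * y₁) * (2 + Real.pi) / |μ₁| * (1 / |φ₀ + ν * y₁ - ω| + 1 / |φ₀ + ν * y₁ + ω|) * r) +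
      (‖c₂‖ * Real.exp (μ₂ * y₂) * (2 + Real.pi) / |μ₂| * (1 / |φ₀ + ν * y₂ - ω| + 1 / |φ₀ + ν * y₂ + ω|) * r +
        ‖c₂‖ * Real.exp (μ₂ * y₁) * (2 + Real.pi) / |μ₂| * (1 / |φ₀ + ν * y₁ - ω| + 1 / |φ₀ + ν * y₁ + ω|) * r) := by
  -- the four Lorentzian terms
  set T : ℂ → ℝ → ℝ → ℝ → ℂ := fun c μ y s =>
    (k s : ℂ) * (Complex.exp ((((φ₀ + ν * y) * s : ℝ)) * Complex.I) *
      ((c * Complex.exp ((μ * y : ℝ)) * Complex.exp ((ν₀ * y : ℝ) * Complex.I)) / ((μ : ℂ) + ((ν₀ + ν * s : ℝ) : ℂ) * Complex.I))) with hT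
  have hpt : ∀ s : ℝ, (k s : ℂ) * (Complex.exp ((φ₀ * s : ℝ) * Complex.I) *
        (c₁ * ((Complex.exp (((μ₁ : ℂ) + ((ν₀ + ν * s : ℝ) : ℂ) * Complex.I) * y₂) -
                Complex.exp (((μ₁ : ℂ) + ((ν₀ + ν * s : ℝ) : ℂ) * Complex.I) * y₁)) / ((μ₁ : ℂ) + ((ν₀ + ν * s : ℝ) : ℂ) * Complex.I)) +
         c₂ * ((Complex.exp (((μ₂ : ℂ) + ((ν₀ + ν * s : ℝ) : ℂ) * Complex.I) * y₂) -
                Complex.exp (((μ₂ : ℂ) + ((ν₀ + ν * s : ℝ) : ℂ) * Complex.I) * y₁)) / ((μ₂ : ℂ) + ((ν₀ + ν * s : ℝ) : ℂ) * Complex.I)))) =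
      (T c₁ μ₁ y₂ s - T c₁ μ₁ y₁ s) + (T c₂ μ₂ y₂ s - T c₂ μ₂ y₁ s) := by
    intro s
    simp only [hT]
    rw [← pieceTerm_eq c₁ μ₁ ν₀ ν φ₀ y₂ s, ← pieceTerm_eq c₁ μ₁ ν₀ ν φ₀ y₁ s, ← pieceTerm_eq c₂ μ₂ ν₀ ν φ₀ y₂ s,
      ← pieceTerm_eq c₂ μ₂ ν₀ ν φ₀ y₁ s]
    ring
  simp_rw [hpt]
  -- integrability
  have hTi : ∀ (c : ℂ) (μ y : ℝ), μ ≠ 0 → IntervalIntegrable (T c μ y) volume 0 θ := by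
    intro c μ y hμ
    exact (continuous_kernel_mul_lorentz hk _ hμ _ _ _).intervalIntegrable _ _
  rw [intervalIntegral.integral_add ((hTi c₁ μ₁ y₂ hμ₁).sub (hTi c₁ μ₁ y₁ hμ₁)) ((hTi c₂ μ₂ y₂ hμ₂).sub (hTi c₂ μ₂ y₁ hμ₂)),
    intervalIntegral.integral_sub (hTi c₁ μ₁ y₂ hμ₁) (hTi c₁ μ₁ y₁ hμ₁), intervalIntegral.integral_sub (hTi c₂ μ₂ y₂ hμ₂) (hTi c₂ μ₂ y₁ hμ₂)]
  -- per-term bounds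
  have hB : ∀ (c : ℂ) (μ y : ℝ), μ ≠ 0 → φ₀ + ν * y - ω ≠ 0 → φ₀ + ν * y + ω ≠ 0 →
      ‖∫ s in (0 : ℝ)..θ, T c μ y s‖ ≤ ‖c‖ * Real.exp (μ * y) * (2 + Real.pi) / |μ| * (1 / |φ₀ + ν * y - ω| + 1 / |φ₀ + ν * y + ω|) * r := by
    intro c μ y hμ hm hp
    have h := hterm (c * Complex.exp ((μ * y : ℝ)) * Complex.exp ((ν₀ * y : ℝ) * Complex.I)) μ (φ₀ + ν * y) ν₀ ν hμ hm hp
    have hn : ‖c * Complex.exp ((μ * y : ℝ)) * Complex.exp ((ν₀ * y : ℝ) * Complex.I)‖ = ‖c‖ * Real.exp (μ * y) := by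
      rw [norm_mul, norm_mul, Complex.norm_exp_ofReal_mul_I, mul_one, ← Complex.ofReal_exp, Complex.norm_real, Real.norm_eq_abs,
        abs_of_pos (Real.exp_pos _)]
    rw [hn] at h
    have hfun : T c μ y = fun s => (k s : ℂ) * Complex.exp (((φ₀ + ν * y) * s : ℝ) * Complex.I) *
        ((c * Complex.exp ((μ * y : ℝ)) * Complex.exp ((ν₀ * y : ℝ) * Complex.I)) / ((μ : ℂ) + ((ν₀ + ν * s : ℝ) : ℂ) * Complex.I)) := by
      funext s; simp only [hT]; ring
    rw [hfun]
    exact h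
  calc _ ≤ ‖(∫ s in (0 : ℝ)..θ, T c₁ μ₁ y₂ s) - ∫ s in (0 : ℝ)..θ, T c₁ μ₁ y₁ s‖ +
        ‖(∫ s in (0 : ℝ)..θ, T c₂ μ₂ y₂ s) - ∫ s in (0 : ℝ)..θ, T c₂ μ₂ y₁ s‖ := norm_add_le _ _
    _ ≤ (‖∫ s in (0 : ℝ)..θ, T c₁ μ₁ y₂ s‖ + ‖∫ s in (0 : ℝ)..θ, T c₁ μ₁ y₁ s‖) +
        (‖∫ s in (0 : ℝ)..θ, T c₂ μ₂ y₂ s‖ + ‖∫ s in (0 : ℝ)..θ, T c₂ μ₂ y₁ s‖) := add_le_add (norm_sub_le _ _) (norm_sub_le _ _)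
    _ ≤ _ := add_le_add (add_le_add (hB c₁ μ₁ y₂ hμ₁ h2m h2p) (hB c₁ μ₁ y₁ hμ₁ h1m h1p))
        (add_le_add (hB c₂ μ₂ y₂ hμ₂ h2m h2p) (hB c₂ μ₂ y₁ hμ₂ h1m h1p))

/-! ## §3 The two propagator entries -/

/-- **Piece response, cosine entry** (`r = 1/2`; per-term bound `norm_integral_cos_mul_lorentz_le`). [folklore] -/
theorem norm_integral_cos_piece_le {ω θ : ℝ} (hθ : 0 ≤ θ) (c₁ c₂ : ℂ) {μ₁ μ₂ : ℝ} (hμ₁ : μ₁ ≠ 0) (hμ₂ : μ₂ ≠ 0)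
    (ν₀ ν φ₀ y₁ y₂ : ℝ)
    (h1m : φ₀ + ν * y₁ - ω ≠ 0) (h1p : φ₀ + ν * y₁ + ω ≠ 0) (h2m : φ₀ + ν * y₂ - ω ≠ 0) (h2p : φ₀ + ν * y₂ + ω ≠ 0) :
    ‖∫ s in (0 : ℝ)..θ, (Real.cos (ω * (θ - s)) : ℂ) * (Complex.exp ((φ₀ * s : ℝ) * Complex.I) *
        (c₁ * ((Complex.exp (((μ₁ : ℂ) + ((ν₀ + ν * s : ℝ) : ℂ) * Complex.I) * y₂) -
                Complex.exp (((μ₁ : ℂ) + ((ν₀ + ν * s : ℝ) : ℂ) * Complex.I) * y₁)) / ((μ₁ : ℂ) + ((ν₀ + ν * s : ℝ) : ℂ) * Complex.I)) +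
         c₂ * ((Complex.exp (((μ₂ : ℂ) + ((ν₀ + ν * s : ℝ) : ℂ) * Complex.I) * y₂) -
                Complex.exp (((μ₂ : ℂ) + ((ν₀ + ν * s : ℝ) : ℂ) * Complex.I) * y₁)) / ((μ₂ : ℂ) + ((ν₀ + ν * s : ℝ) : ℂ) * Complex.I))))‖ ≤
      (‖c₁‖ * Real.exp (μ₁ * y₂) * (2 + Real.pi) / |μ₁| * (1 / |φ₀ + ν * y₂ - ω| + 1 / |φ₀ + ν * y₂ + ω|) * (1 / 2) +
        ‖c₁‖ * Real.exp (μ₁ * y₁) * (2 + Real.pi) / |μ₁| * (1 / |φ₀ + ν * y₁ - ω| + 1 / |φ₀ + ν * y₁ + ω|) * (1 / 2)) +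
      (‖c₂‖ * Real.exp (μ₂ * y₂) * (2 + Real.pi) / |μ₂| * (1 / |φ₀ + ν * y₂ - ω| + 1 / |φ₀ + ν * y₂ + ω|) * (1 / 2) +
        ‖c₂‖ * Real.exp (μ₂ * y₁) * (2 + Real.pi) / |μ₂| * (1 / |φ₀ + ν * y₁ - ω| + 1 / |φ₀ + ν * y₁ + ω|) * (1 / 2)) := by
  refine norm_integral_kernel_piece_le (k := fun s => Real.cos (ω * (θ - s))) (by fun_prop) ?_ c₁ c₂ hμ₁ hμ₂ ν₀ ν φ₀ y₁ y₂ h1m h1p h2m h2p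
  intro C μ φ ν₀' ν' hμ hm hp
  exact (norm_integral_cos_mul_lorentz_le C hμ hm hp ν₀' ν' hθ).trans (le_of_eq (by ring))

/-- **Piece response, sine entry** (`r = 1/(2|ω|)`; per-term bound `norm_integral_sin_mul_lorentz_le`). [folklore] -/
theorem norm_integral_sin_piece_le {ω θ : ℝ} (hω : ω ≠ 0) (hθ : 0 ≤ θ) (c₁ c₂ : ℂ) {μ₁ μ₂ : ℝ} (hμ₁ : μ₁ ≠ 0) (hμ₂ : μ₂ ≠ 0)
    (ν₀ ν φ₀ y₁ y₂ : ℝ)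
    (h1m : φ₀ + ν * y₁ - ω ≠ 0) (h1p : φ₀ + ν * y₁ + ω ≠ 0) (h2m : φ₀ + ν * y₂ - ω ≠ 0) (h2p : φ₀ + ν * y₂ + ω ≠ 0) :
    ‖∫ s in (0 : ℝ)..θ, ((Real.sin (ω * (θ - s)) / ω : ℝ) : ℂ) * (Complex.exp ((φ₀ * s : ℝ) * Complex.I) *
        (c₁ * ((Complex.exp (((μ₁ : ℂ) + ((ν₀ + ν * s : ℝ) : ℂ) * Complex.I) * y₂) -
                Complex.exp (((μ₁ : ℂ) + ((ν₀ + ν * s : ℝ) : ℂ) * Complex.I) * y₁)) / ((μ₁ : ℂ) + ((ν₀ + ν * s : ℝ) : ℂ) * Complex.I)) +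
         c₂ * ((Complex.exp (((μ₂ : ℂ) + ((ν₀ + ν * s : ℝ) : ℂ) * Complex.I) * y₂) -
                Complex.exp (((μ₂ : ℂ) + ((ν₀ + ν * s : ℝ) : ℂ) * Complex.I) * y₁)) / ((μ₂ : ℂ) + ((ν₀ + ν * s : ℝ) : ℂ) * Complex.I))))‖ ≤
      (‖c₁‖ * Real.exp (μ₁ * y₂) * (2 + Real.pi) / |μ₁| * (1 / |φ₀ + ν * y₂ - ω| + 1 / |φ₀ + ν * y₂ + ω|) * (1 / (2 * |ω|)) +
        ‖c₁‖ * Real.exp (μ₁ * y₁) * (2 + Real.pi) / |μ₁| * (1 / |φ₀ + ν * y₁ - ω| + 1 / |φ₀ + ν * y₁ + ω|) * (1 / (2 * |ω|))) +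
      (‖c₂‖ * Real.exp (μ₂ * y₂) * (2 + Real.pi) / |μ₂| * (1 / |φ₀ + ν * y₂ - ω| + 1 / |φ₀ + ν * y₂ + ω|) * (1 / (2 * |ω|)) +
        ‖c₂‖ * Real.exp (μ₂ * y₁) * (2 + Real.pi) / |μ₂| * (1 / |φ₀ + ν * y₁ - ω| + 1 / |φ₀ + ν * y₁ + ω|) * (1 / (2 * |ω|))) := by
  refine norm_integral_kernel_piece_le (k := fun s => Real.sin (ω * (θ - s)) / ω) (by fun_prop) ?_ c₁ c₂ hμ₁ hμ₂ ν₀ ν φ₀ y₁ y₂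
    h1m h1p h2m h2p
  intro C μ φ ν₀' ν' hμ hm hp
  exact (norm_integral_sin_mul_lorentz_le C hμ hω hm hp ν₀' ν' hθ).trans (le_of_eq (by ring))

end Summit.AnomalousDissipation.AnomalousDissipation.Theorems.SawtoothPulseCascade.K2PhaseBudget

end
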